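import Literature.Probability.RandomPlanarGeometry.HexSAWBrickWallBridgeKesten
import Literature.Probability.RandomPlanarGeometry.SAWBridgeTwoStepRate
import Literature.Probability.RandomPlanarGeometry.SAWTriangularBridgeRatioRate
import Mathlib.Analysis.SpecialFunctions.Pow.Asymptotics
import HarnessLib

/-!
# The two-step ratio limit theorem for bridges of the honeycomb lattice, with its mixed rate («HEX-BRIDGE-RATIO-2»)

Topic `Literature/Probability/RandomPlanarGeometry` (lane «pcv-sawmu», route R76; continues
`HexSAWBrickWallBridgeKesten.lean`). Sources: N. Madras, G. Slade, *The Self-Avoiding Walk* (1993), Lemma 7.3.1 p. 242,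
Theorem 7.3.4(d) p. 248 ("`lim_{N→∞} b_{N+1}/b_N = μ`", on `ℤ^d`, via (7.3.13) and the renewal theorem), §7.5 (7.5.1)–(7.5.2)
p. 255 (Kesten's rates); H. Duminil-Copin, S. Smirnov, Ann. Math. 175 (2012), Theorem 1 (`μ_ℍ = √(2+√2)`).

**`hexBridgeRatioTwo : b_{N+2}(ℍ)/b_N(ℍ) → 2 + √2 = μ_ℍ²`** and the mixed rate **`hexBridgeRatioTwo_rate_mixed`**:
`−K N^{−1/3} ≤ b_{N+2}(ℍ)/b_N(ℍ) − (2+√2) ≤ K N^{−1/4}` for `N ≥ N₀` — from the crux `hexBridgeKestenTwo`, `b_n ≤ b_{n+2}`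
and `b_m b_n ≤ b_{m+n}` (`HexSAWBrickWallBridges`), `b_n ≤ μ_ℍ^n`, `e^{−9√n} μ_ℍ^n ≤ b_n`, through the tree's two-step
rate cores `Zd.lower_rate_core` / `Zd.upper_rate_core` (`SAWBridgeTwoStepRate`). The glue (§2) is planner a-idea-1 gen 13's
`Sketch_G13_R76v2` (f221ebfa), consumed verbatim; the abstract lemmas `kesten_B_form_of_product_two` / `twoStep_rate_mixed` are
imported from the tree's `SAWTriangularBridgeRatioRate.lean` (R73, the same §1 text).
On `ℍ` the one-step ratio `b_{N+1}/b_N` has no limit (bipartite lattice), whence the two-step statement. Status in print: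
for `ℤ^d` the two-step bridge ratio LIMIT is printed and proved — M–S (7.3.13) p. 248 (Lemma 7.3.1 with `a_N = b_N`,
Kesten's inequality for bridges = Theorem 7.3.2(b), (7.3.4) p. 244; tree `Zd.MadrasSlade1993_eq7313` / `_thm732b`), the
one-step Theorem 7.3.4(d) by renewal theory (tree `Zd.MadrasSlade1993_thm734d`); NO convergence rate for bridge ratios is
printed on any lattice; for `ℍ` neither limit nor rate is printed — first written and kernel-checked here (the honeycomb
port of that chapter); grade: new in writing for `ℍ` / consolidation+, no novelty claimed beyond that.

## Contents (namespace `Literature.Probability.RandomPlanarGeometry.SAW.HV`; all PROVED, axioms standard)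

* **`hexBridgeRatioTwo_rate_mixed`**, **`hexBridgeRatioTwo`**.
-/

noncomputable section

open Finset Filter Topology Literature.Probability.LatticeModels SimpleGraph
open scoped BigOperators

namespace Literature.Probability.RandomPlanarGeometry.SAW.HV

section GlueR76

/-- **R76b «HEX-BRIDGE-RATIO-2-RATE» (mixed exponents)**: `−K N^{−1/3} ≤ b_{N+2}(ℍ)/b_N(ℍ) − (2+√2) ≤ K N^{−1/4}`
for `N ≥ N₀`. Inputs: the crux `hexBridgeKestenTwo`, `b_n ≤ b_{n+2}` and `b_m b_n ≤ b_{m+n}` (`HexSAWBrickWallBridges`),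
`b_n ≤ μ_ℍ^n`, `e^{−9√n} μ_ℍ^n ≤ b_n`, `μ_ℍ² = 2 + √2` (Duminil-Copin–Smirnov). Status in print: for `ℤ^d` the two-step
bridge ratio LIMIT is printed and proved (M–S (7.3.13), p. 248, proof of Theorem 7.3.4(d): Lemma 7.3.1 with `a_N = b_N`; tree
`Zd.MadrasSlade1993_eq7313`), the one-step limit Theorem 7.3.4(d) by renewal theory; NO convergence RATE for bridge ratios is
printed on any lattice; for `ℍ` neither limit nor rate is printed — first written and kernel-checked here, no novelty claimed
beyond that. [cite: MadrasSlade1993, Theorem 7.3.4 (d), proof, eq. (7.3.13) p. 248; DuminilCopinSmirnov2012, Theorem 1] -/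
theorem hexBridgeRatioTwo_rate_mixed :
    ∃ K : ℝ, ∃ N₀ : ℕ, ∀ N : ℕ, N₀ ≤ N →
      -(K * (N : ℝ) ^ (-(1 : ℝ) / 3)) ≤ (HexBW.bridgeCount (N + 2) : ℝ) / HexBW.bridgeCount N - (2 + Real.sqrt 2) ∧
        (HexBW.bridgeCount (N + 2) : ℝ) / HexBW.bridgeCount N - (2 + Real.sqrt 2) ≤ K * (N : ℝ) ^ (-(1 : ℝ) / 4) := by
  have hhex : hexConnectiveConstant = Real.sqrt (2 + Real.sqrt 2) :=
    hexConnectiveConstant_eq_of_thm1 DuminilCopinSmirnov2012_thm1_holds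
  have hsq : hexConnectiveConstant ^ 2 = 2 + Real.sqrt 2 := by rw [hhex, Real.sq_sqrt (by positivity)]
  have hμ0 : 0 < hexConnectiveConstant := hexConnectiveConstant_pos
  have hb : ∀ n, (0 : ℝ) < HexBW.bridgeCount n := fun n => by exact_mod_cast HexBW.one_le_bridgeCount n
  have hmono' : ∀ n, (HexBW.bridgeCount n : ℝ) ≤ HexBW.bridgeCount (n + 2) := fun n => by
    exact_mod_cast HexBW.bridgeCount_le_add n 2
  have hsup' : ∀ n m : ℕ, (HexBW.bridgeCount n : ℝ) * HexBW.bridgeCount m ≤ HexBW.bridgeCount (n + m) := fun n m => by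
    exact_mod_cast HexBW.bridgeCount_mul_le n m
  obtain ⟨D, hD1, N₁, hB⟩ := kesten_B_form_of_product_two hb hmono' hexBridgeKestenTwo
  obtain ⟨K, -, N₀, hN₀⟩ := twoStep_rate_mixed (N₁ := N₁) hb hμ0 hD1 (by norm_num : (0 : ℝ) ≤ 9)
    hB hsup' HexBW.bridgeCount_le_pow hexBridgeLo
  refine ⟨K, N₀, fun N hN => ?_⟩
  rw [← hsq]
  exact hN₀ N hN

/-- **R76a «HEX-BRIDGE-RATIO-2»: `b_{N+2}(ℍ)/b_N(ℍ) → 2 + √2 = μ_ℍ²`** — the two-step ratio limit theorem for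
bridges of the honeycomb lattice (Madras–Slade Theorem 7.3.4(d)-type statement; on `ℍ` the one-step ratio has no limit by
bipartiteness). Status in print: for `ℤ^d` printed and proved — two-step (7.3.13) p. 248 (tree
`Zd.MadrasSlade1993_eq7313`), one-step Theorem 7.3.4(d) p. 248 via renewal theory (tree `Zd.MadrasSlade1993_thm734d`); for
`ℍ` never written; here by Madras–Slade's own architecture on `ℍ` — Kesten's hexagon surgery restricted to bridges +
the lane's pattern-free density and Hammersley–Welsh envelope —, kernel-checked.
[cite: MadrasSlade1993, Theorem 7.3.4 (d), proof, eq. (7.3.13) p. 248; DuminilCopinSmirnov2012, Theorem 1] -/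
theorem hexBridgeRatioTwo :
    Tendsto (fun N : ℕ => (HexBW.bridgeCount (N + 2) : ℝ) / HexBW.bridgeCount N) atTop (𝓝 (2 + Real.sqrt 2)) := by
  obtain ⟨K, N₀, hN₀⟩ := hexBridgeRatioTwo_rate_mixed
  have h3 : Tendsto (fun N : ℕ => K * (N : ℝ) ^ (-(1 : ℝ) / 3)) atTop (𝓝 0) := by
    have := (tendsto_rpow_neg_atTop (by norm_num : (0 : ℝ) < 1 / 3)).comp tendsto_natCast_atTop_atTop
    simpa [neg_div] using this.const_mul K
  have h4 : Tendsto (fun N : ℕ => K * (N : ℝ) ^ (-(1 : ℝ) / 4)) atTop (𝓝 0) := by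
    have := (tendsto_rpow_neg_atTop (by norm_num : (0 : ℝ) < 1 / 4)).comp tendsto_natCast_atTop_atTop
    simpa [neg_div] using this.const_mul K
  have hdiff : Tendsto (fun N : ℕ => (HexBW.bridgeCount (N + 2) : ℝ) / HexBW.bridgeCount N - (2 + Real.sqrt 2))
      atTop (𝓝 0) := by
    refine tendsto_of_tendsto_of_tendsto_of_le_of_le' (by simpa using h3.neg) h4 ?_ ?_
    · exact Filter.eventually_atTop.2 ⟨N₀, fun N hN => (hN₀ N hN).1⟩
    · exact Filter.eventually_atTop.2 ⟨N₀, fun N hN => (hN₀ N hN).2⟩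
  have := hdiff.add_const (2 + Real.sqrt 2)
  simpa using this

end GlueR76

end Literature.Probability.RandomPlanarGeometry.SAW.HV
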